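import Mathlib.Algebra.Order.Antidiag.Finsupp
import Literature.Computability.AlgebraicComplexity.BLMW11WeaklySkewDetProofs
import Literature.Computability.AlgebraicComplexity.HI16DetSkewCircuitProofs
import HarnessLib

/-!
# BLMW 2011 §9.3: `\overline{VP_ws}` is closed under p-projections (Zariski-closure transport)

Bürgisser–Landsberg–Manivel–Weyman, *An overview of mathematical issues arising in the geometric
complexity theory approach to VP ≠ VNP*, SIAM J. Comput. 40 (2011), §9.3 (arXiv:0907.2850,
p. 21): "Clearly, `\overline{VP_ws} ⊆ \overline{VP}` and both classes are closed under
p-projections." This file proves the `\overline{VP_ws}` half of that sentence for the tree's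
rendering `approxWsComplexity` / `IsVPwsBarFamily` (`BLMW11KroneckerApproximation.lean`, Zariski
closure in coefficient space), together with the transport lemma behind it, which is also the
engine of the proof of BLMW Prop. 9.3.2 (`per ∉ \overline{VP_ws}` ⇔ Mulmuley–Sohoni):

* `coeffVec_linearMap_mem_zariskiClosure` — **Zariski-closure transport under linear maps on
  bounded supports**: if `S` is a set of polynomials whose supports lie in a fixed finite set `B`
  of monomials, `L` is any `k`-linear map of polynomial rings and `coeffVec f` lies in the Zariski
  closure of `coeffVec '' S`, then `coeffVec (L f)` lies in the Zariski closure of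
  `coeffVec '' (L '' S)` (pull the test polynomial back along the finitely supported matrix of
  `L`; the pattern of `aeval_coeffVec_linSubstPullback` in `OrbitClosureProofs.lean`).
* `ArithCircuit.IsWeaklySkew.substIn`, `ArithCircuit.WellFormed.substIn` — input substitution
  (variables ↦ variables or constants, `ArithCircuit.substIn` of `HI16DetSkewCircuitProofs.lean`)
  keeps a circuit weakly skew and well formed (it does not touch gate references), whence
  `wsComplexity (aeval (inputVal φ) f) ≤ wsComplexity f` and `IsProjection.wsComplexity_le`.
* `totalDegree_le_wsComplexity_succ` — `deg f ≤ L_ws(f) + 1` (BLMW §9.1, via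
  `BLMW11WeaklySkewDegree.lean`), so the sets `{g | L_ws(g) ≤ r}` have bounded supports.
* `IsProjection.approxWsComplexity_le`, `approxWsComplexity_rename_equiv` — the approximate
  weakly-skew complexity does not increase under Valiant projections and is invariant under
  renaming along a bijection.
* `IsVPwsBarFamily.of_isPProjection` (and `IsVPwsFamily.of_isPProjection`) — the printed
  sentence: `\overline{VP_ws}` (and `VP_ws`) are closed under p-projections.

All statements are theorems (no new definitions, no named facts); cell `val-lit`, seat t14.

## References
* [BLMW 2011] P. Bürgisser, J. M. Landsberg, L. Manivel, J. Weyman, SIAM J. Comput. 40 (2011),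
  §9.1, §9.3 (arXiv:0907.2850, pp. 20–21). Bib key `BurgisserEtAl2011`.
-/

open MvPolynomial

namespace Literature.Computability.AlgebraicComplexity

/-! ### Zariski-closure transport under linear maps (coefficient space) -/

section Transport

variable {k : Type*} [Field k] {σ τ : Type*}

/-- A coordinate function `coeff d` vanishing on `S` vanishes on the Zariski closure of
`coeffVec '' S` (test polynomial `X_d`); Mulmuley–Sohoni 2001 §4 (coordinates on `V`). [cite: MulmuleySohoni2001, §4] -/
theorem coeff_eq_zero_of_coeffVec_mem_zariskiClosure {S : Set (MvPolynomial σ k)}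
    {f : MvPolynomial σ k} (hf : coeffVec f ∈ zariskiClosure (coeffVec '' S)) {d : σ →₀ ℕ}
    (hS : ∀ g ∈ S, coeff d g = 0) : coeff d f = 0 := by
  have h := (mem_zariskiClosure_iff.mp hf) (X d) (by
    rintro _ ⟨g, hg, rfl⟩
    rw [aeval_X, coeffVec_apply, hS g hg])
  rwa [aeval_X, coeffVec_apply] at h

/-- If every member of `S` is supported in the finite set `B` of monomials, so is every polynomial
in the Zariski closure of `coeffVec '' S` (BLMW 2011 §9.3: the closure is taken inside a
finite-dimensional piece `{deg ≤ d}` of `A`). [cite: BurgisserEtAl2011, §9.3 (Def. 9.3.1)] -/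
theorem support_subset_of_coeffVec_mem_zariskiClosure {S : Set (MvPolynomial σ k)}
    {B : Finset (σ →₀ ℕ)} (hS : ∀ g ∈ S, g.support ⊆ B) {f : MvPolynomial σ k}
    (hf : coeffVec f ∈ zariskiClosure (coeffVec '' S)) : f.support ⊆ B := by
  intro d hd
  by_contra hdB
  exact (mem_support_iff.mp hd) (coeff_eq_zero_of_coeffVec_mem_zariskiClosure hf
    fun g hg => notMem_support_iff.mp fun h => hdB (hS g hg h))

/-- Matrix expansion of a linear map on a polynomial supported in `B`:
`coeff e (L g) = ∑_{d ∈ B} coeff d g · coeff e (L X^d)` (the matrix of a linear map in the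
monomial basis; Mulmuley–Sohoni 2001 §4). [cite: MulmuleySohoni2001, §4] -/
theorem coeff_linearMap_eq_sum_of_support_subset (L : MvPolynomial σ k →ₗ[k] MvPolynomial τ k)
    {B : Finset (σ →₀ ℕ)} {g : MvPolynomial σ k} (hg : g.support ⊆ B) (e : τ →₀ ℕ) :
    coeff e (L g) = ∑ d ∈ B, coeff d g * coeff e (L (monomial d 1)) := by
  have hpt : ∀ d : σ →₀ ℕ,
      coeff e (L (monomial d (coeff d g))) = coeff d g * coeff e (L (monomial d 1)) := by
    intro d
    have hsplit : (monomial d (coeff d g) : MvPolynomial σ k) = coeff d g • monomial d 1 := by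
      rw [smul_monomial, smul_eq_mul, mul_one]
    rw [hsplit, map_smul, coeff_smul, smul_eq_mul]
  conv_lhs => rw [g.as_sum]
  rw [map_sum, coeff_sum]
  rw [Finset.sum_subset hg (f := fun d => coeff e (L (monomial d (coeff d g)))) (by
    intro d _ hd
    rw [notMem_support_iff.mp hd, monomial_zero, map_zero, coeff_zero])]
  exact Finset.sum_congr rfl fun d _ => hpt d

/-- The pull-back of a test polynomial on `τ`-coefficient space along a linear map `L`, as a test
polynomial on `σ`-coefficient space (substitute the linear form `∑_{d ∈ B} coeff e (L X^d) • X_d`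
for `X_e`), evaluates at `coeffVec g` to the value at `coeffVec (L g)`, for `g` supported in `B`
(as `aeval_coeffVec_linSubstPullback`; Mulmuley–Sohoni 2001 §4). [cite: MulmuleySohoni2001, §4] -/
theorem aeval_coeffVec_linearPullback (L : MvPolynomial σ k →ₗ[k] MvPolynomial τ k)
    {B : Finset (σ →₀ ℕ)} {g : MvPolynomial σ k} (hg : g.support ⊆ B)
    (p : MvPolynomial (τ →₀ ℕ) k) :
    aeval (coeffVec g) (aeval (fun e : τ →₀ ℕ =>
      ∑ d ∈ B, coeff e (L (monomial d 1)) • (X d : MvPolynomial (σ →₀ ℕ) k)) p) =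
      aeval (coeffVec (L g)) p := by
  have hFG : (fun e : τ →₀ ℕ => aeval (coeffVec g)
      (∑ d ∈ B, coeff e (L (monomial d 1)) • (X d : MvPolynomial (σ →₀ ℕ) k))) =
      coeffVec (L g) := by
    funext e
    simp only [map_sum, map_smul, aeval_X, coeffVec_apply, smul_eq_mul]
    rw [coeff_linearMap_eq_sum_of_support_subset L hg]
    exact Finset.sum_congr rfl fun d _ => mul_comm _ _
  rw [← AlgHom.comp_apply, comp_aeval, hFG]

/-- **Zariski-closure transport under linear maps on bounded supports.** Let `S` be a set of
polynomials all supported in a finite set `B` of monomials and `L` a `k`-linear map of polynomial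
rings. If `coeffVec f` lies in the Zariski closure of `coeffVec '' S`, then `coeffVec (L f)` lies
in the Zariski closure of `coeffVec '' (L '' S)`: a test polynomial vanishing on `L '' S` pulls
back (`aeval_coeffVec_linearPullback`) to one vanishing on `S`, hence at `f`, which is supported in
`B` as well (`support_subset_of_coeffVec_mem_zariskiClosure`). This is the continuity of linear
maps used tacitly throughout BLMW 2011 §9.3 ("both classes are closed under p-projections";
proof of Prop. 9.3.2). [cite: BurgisserEtAl2011, §9.3] -/
theorem coeffVec_linearMap_mem_zariskiClosure (L : MvPolynomial σ k →ₗ[k] MvPolynomial τ k)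
    {S : Set (MvPolynomial σ k)} {B : Finset (σ →₀ ℕ)} (hS : ∀ g ∈ S, g.support ⊆ B)
    {f : MvPolynomial σ k} (hf : coeffVec f ∈ zariskiClosure (coeffVec '' S)) :
    coeffVec (L f) ∈ zariskiClosure (coeffVec '' (L '' S)) := by
  have hfB := support_subset_of_coeffVec_mem_zariskiClosure hS hf
  rw [mem_zariskiClosure_iff] at hf ⊢
  intro p hp
  rw [← aeval_coeffVec_linearPullback L hfB]
  apply hf
  rintro _ ⟨g, hg, rfl⟩
  rw [aeval_coeffVec_linearPullback L (hS g hg)]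
  exact hp _ ⟨L g, ⟨g, hg, rfl⟩, rfl⟩

/-- The closure of a set contained in a Zariski-closed "membership" set stays inside: if
`coeffVec '' T ⊆ zariskiClosure U` then `zariskiClosure (coeffVec '' T) ⊆ zariskiClosure U`
(closure is monotone and idempotent; Mumford, Red book I §2). [cite: MulmuleySohoni2001, §4] -/
theorem zariskiClosure_image_subset_of_subset {ι : Type*} {T : Set (MvPolynomial σ k)}
    {U : Set (ι → k)} {c : MvPolynomial σ k → ι → k} (h : c '' T ⊆ zariskiClosure U) :
    zariskiClosure (c '' T) ⊆ zariskiClosure U := by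
  rw [← zariskiClosure_zariskiClosure U]
  exact zariskiClosure_mono h

/-- The finite set of monomials of degree `≤ D` in finitely many variables (as a union of the
antidiagonals `Finset.finsuppAntidiag`), membership criterion — the finite-dimensional pieces
`{f | deg f ≤ d}` of BLMW 2011 §9.3. [cite: BurgisserEtAl2011, §9.3 (Def. 9.3.1)] -/
theorem mem_degBox_iff [Fintype σ] [DecidableEq σ] {D : ℕ} {d : σ →₀ ℕ} :
    d ∈ (Finset.range (D + 1)).biUnion
      (fun n => (Finset.univ : Finset σ).finsuppAntidiag n) ↔ d.degree ≤ D := by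
  have hmem : ∀ n : ℕ,
      d ∈ (Finset.univ : Finset σ).finsuppAntidiag n ↔ d.degree = n := by
    intro n
    simp [Finset.mem_finsuppAntidiag, Finsupp.degree_eq_sum]
  rw [Finset.mem_biUnion]
  constructor
  · rintro ⟨n, hn, h⟩
    rw [hmem] at h
    rw [Finset.mem_range] at hn
    omega
  · intro h
    exact ⟨d.degree, Finset.mem_range.mpr (Nat.lt_succ_of_le h), (hmem _).mpr rfl⟩

/-- A polynomial of total degree `≤ D` is supported in the monomials of degree `≤ D` (the pieces
`{f | deg f ≤ d}` of BLMW 2011 §9.3). [cite: BurgisserEtAl2011, §9.3 (Def. 9.3.1)] -/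
theorem support_subset_degBox_of_totalDegree_le [Fintype σ] [DecidableEq σ] {g : MvPolynomial σ k} {D : ℕ}
    (h : g.totalDegree ≤ D) :
    g.support ⊆ (Finset.range (D + 1)).biUnion
      (fun n => (Finset.univ : Finset σ).finsuppAntidiag n) := by
  intro d hd
  rw [mem_degBox_iff]
  have h1 : (d.sum fun _ e => e) ≤ g.totalDegree := le_totalDegree hd
  have h2 : d.degree = d.sum fun _ e => e := rfl
  omega

end Transport

/-! ### Input substitution keeps circuits weakly skew and well formed -/

namespace ArithCircuit

section SubstIn

variable {k : Type*} {σ τ : Type*}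

/-- Input substitution does not change the gate references of a gate (Bürgisser 2000, Rem. 2.2).
[cite: Burgisser2000, Rem. 2.2] -/
theorem Gate.refs_substIn (φ : σ → τ ⊕ k) (g : Gate k σ) : (g.substIn φ).refs = g.refs := by
  rw [Gate.refs, Gate.refs, Gate.args_substIn, List.filterMap_map]
  congr 1
  funext u
  cases u with
  | var i =>
    simp only [Function.comp_apply, Operand.substIn]
    cases φ i <;> rfl
  | const c => rfl
  | gate j => rfl

/-- Input substitution does not change the reference relation of a circuit (Bürgisser 2000,
Rem. 2.2). [cite: Burgisser2000, Rem. 2.2] -/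
theorem references_substIn_iff (φ : σ → τ ⊕ k) (P : ArithCircuit k σ) (l j : ℕ) :
    (P.substIn φ).References l j ↔ P.References l j := by
  simp only [References, ArithCircuit.substIn, List.getElem?_map]
  constructor
  · rintro ⟨g', hg', hj⟩
    obtain ⟨g, hg, rfl⟩ := Option.map_eq_some_iff.mp hg'
    exact ⟨g, hg, by rwa [Gate.refs_substIn] at hj⟩
  · rintro ⟨g, hg, hj⟩
    exact ⟨g.substIn φ, by simp [hg], by rwa [Gate.refs_substIn]⟩

/-- Input substitution does not change sub-circuits (Bürgisser 2000, Rem. 2.2; BLMW 2011 §9.1).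
[cite: Burgisser2000, Rem. 2.2] -/
theorem subcircuit_substIn (φ : σ → τ ⊕ k) (P : ArithCircuit k σ) (j : ℕ) :
    (P.substIn φ).subcircuit j = P.subcircuit j := by
  have h : (P.substIn φ).References = P.References := by
    funext l j'
    exact propext (references_substIn_iff φ P l j')
  simp only [subcircuit, h]

/-- Input substitution does not change the "separate operand" property (BLMW 2011 §9.1).
[cite: BurgisserEtAl2011, §9.1 (weakly-skew circuits)] -/
theorem isSeparateOperand_substIn_iff (φ : σ → τ ⊕ k) (P : ArithCircuit k σ) (i j : ℕ) :
    (P.substIn φ).IsSeparateOperand i j ↔ P.IsSeparateOperand i j := by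
  simp only [IsSeparateOperand, subcircuit_substIn]
  constructor
  · intro h l hl g hg j' hj'
    have h' := h l hl (g.substIn φ) (by simp [ArithCircuit.substIn, hg]) j' hj'
    rwa [Gate.refs_substIn] at h'
  · intro h l hl g' hg' j' hj'
    simp only [ArithCircuit.substIn, List.getElem?_map] at hg'
    obtain ⟨g, hg, rfl⟩ := Option.map_eq_some_iff.mp hg'
    rw [Gate.refs_substIn]
    exact h l hl g hg j' hj'

/-- **Input substitution keeps a circuit weakly skew** (BLMW 2011 §9.1: the separate sub-circuits
are untouched; substituted input operands stay inputs). [cite: BurgisserEtAl2011, §9.1 (weakly-skew circuits)] -/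
theorem IsWeaklySkew.substIn {P : ArithCircuit k σ} (h : P.IsWeaklySkew) (φ : σ → τ ⊕ k) :
    (P.substIn φ).IsWeaklySkew := by
  intro i args' hg' hne
  simp only [ArithCircuit.substIn, List.getElem?_map] at hg'
  obtain ⟨g, hg, hgg'⟩ := Option.map_eq_some_iff.mp hg'
  cases g with
  | sum as => simp [Gate.substIn] at hgg'
  | prod args =>
    simp only [Gate.substIn, Gate.prod.injEq] at hgg'
    subst hgg'
    have hne' : args ≠ [] := by
      rintro rfl
      exact hne rfl
    obtain ⟨u, hu, hu'⟩ := h i args hg hne'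
    refine ⟨u.substIn φ, List.mem_map.mpr ⟨u, hu, rfl⟩, ?_⟩
    rcases hu' with h0 | ⟨j, rfl, hsep⟩
    · left
      rw [Operand.isGateRef_substIn]
      exact h0
    · right
      exact ⟨j, rfl, (isSeparateOperand_substIn_iff φ P i j).mpr hsep⟩

/-- Input substitution keeps a circuit well formed (gate references are unchanged; Bürgisser 2000,
Rem. 2.2). [cite: Burgisser2000, Rem. 2.2] -/
theorem WellFormed.substIn {P : ArithCircuit k σ} (h : P.WellFormed) (φ : σ → τ ⊕ k) :
    (P.substIn φ).WellFormed := by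
  have hop : ∀ (u : Operand k σ) (n : ℕ), u.RefsBelow n → (u.substIn φ).RefsBelow n := by
    intro u n hu
    cases u with
    | var i =>
      simp only [Operand.substIn]
      cases φ i with
      | inl j => trivial
      | inr c => trivial
    | const c => trivial
    | gate j => exact hu
  refine ⟨fun i g' hg' u' hu' => ?_, ?_⟩
  · simp only [ArithCircuit.substIn, List.getElem?_map] at hg'
    obtain ⟨g, hg, rfl⟩ := Option.map_eq_some_iff.mp hg'
    rw [Gate.args_substIn, List.mem_map] at hu'
    obtain ⟨u, hu, rfl⟩ := hu'
    exact hop u i (h.1 i g hg u hu)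
  · rw [size_substIn]
    exact hop P.output P.size h.2

end SubstIn

end ArithCircuit

/-! ### `L_ws` under projections; degree bound -/

section WsProjection

variable {k : Type*} [CommSemiring k] {σ τ : Type*}

open ArithCircuit

/-- **`deg f ≤ L_ws(f) + 1`** (BLMW 2011 §9.1: "the degree of the polynomial computed by a
weakly-skew circuit is bounded by its size", for the corrected well-formed notion and the tree's
gate count, at a size-optimal circuit `HI16Skew.wsComplexity_attained`).
[cite: BurgisserEtAl2011, §9.1 (VP_ws)] -/
theorem totalDegree_le_wsComplexity_succ (f : MvPolynomial σ k) :
    f.totalDegree ≤ wsComplexity f + 1 := by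
  obtain ⟨P, hwf, h2, hws, hc, hsz⟩ := HI16Skew.wsComplexity_attained f
  rw [ArithCircuit.Computes] at hc
  rw [← hsz, ← hc]
  exact P.totalDegree_eval_le_of_isWeaklySkew hwf h2 hws

/-- **`L_ws` does not increase under input substitution** (variables ↦ variables or constants):
substitute in a size-optimal well-formed weakly-skew circuit. [cite: BurgisserEtAl2011, §9.3 (closed under p-projections)] -/
theorem wsComplexity_aeval_inputVal_le (φ : σ → τ ⊕ k) (f : MvPolynomial σ k) :
    wsComplexity (aeval (inputVal φ) f) ≤ wsComplexity f := by
  obtain ⟨P, hwf, h2, hws, hc, hsz⟩ := HI16Skew.wsComplexity_attained f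
  rw [ArithCircuit.Computes] at hc
  rw [← hsz, ← size_substIn φ P]
  refine wsComplexity_le_size _ (hwf.substIn φ) (h2.substIn φ) (hws.substIn φ) ?_
  rw [ArithCircuit.Computes, eval_substIn, hc]

/-- A Valiant projection is an input substitution `aeval (inputVal φ)` (Bürgisser 2000,
Def. 2.6(1)). [cite: Burgisser2000, Def. 2.6(1)] -/
theorem IsProjection.exists_inputVal {g : MvPolynomial τ k} {f : MvPolynomial σ k}
    (h : IsProjection g f) : ∃ φ : σ → τ ⊕ k, g = aeval (inputVal φ) f := by
  obtain ⟨a, ha, rfl⟩ := h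
  have hv : ∀ i, ∃ v : τ ⊕ k, a i = inputVal (fun _ : σ => v) i := by
    intro i
    rcases ha i with ⟨j, hj⟩ | ⟨c, hc⟩
    · exact ⟨Sum.inl j, by rw [hj]; rfl⟩
    · exact ⟨Sum.inr c, by rw [hc]; rfl⟩
  choose φ hφ using hv
  refine ⟨φ, ?_⟩
  have ha' : a = inputVal φ := by
    funext i
    rw [hφ i]
    rfl
  rw [ha']

/-- **`L_ws` does not increase under Valiant projections.** [cite: BurgisserEtAl2011, §9.3 (closed under p-projections)] -/
theorem IsProjection.wsComplexity_le {g : MvPolynomial τ k} {f : MvPolynomial σ k}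
    (h : IsProjection g f) : wsComplexity g ≤ wsComplexity f := by
  obtain ⟨φ, rfl⟩ := h.exists_inputVal
  exact wsComplexity_aeval_inputVal_le φ f

/-- **`VP_ws` is closed under p-projections** (BLMW 2011 §9.1/§9.3, corrected notion).
[cite: BurgisserEtAl2011, §9.3 (closed under p-projections)] -/
theorem IsVPwsFamily.of_isPProjection {σ' τ' : ℕ → Type*} {f : ∀ n, MvPolynomial (σ' n) k}
    {g : ∀ n, MvPolynomial (τ' n) k} (hg : IsVPwsFamily g) (h : IsPProjection f g) :
    IsVPwsFamily f := by
  obtain ⟨t, ht, hproj⟩ := h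
  exact (IsPBounded.comp_holds hg ht).mono fun n => (hproj n).wsComplexity_le

end WsProjection

/-! ### `\underline{L_ws}` under projections; `\overline{VP_ws}` is closed under p-projections -/

section ApproxProjection

variable {σ τ : Type*}

/-- The infimum defining `\underline{L_ws}(f)` is attained: `f` lies in the closure of
`{g | L_ws(g) ≤ \underline{L_ws}(f)}` (the defining set of `r`'s contains `L_ws(f)`).
[cite: BurgisserEtAl2011, Def. 9.3.1] -/
theorem coeffVec_mem_zariskiClosure_approxWsComplexity (f : MvPolynomial σ ℂ) :
    coeffVec f ∈ zariskiClosure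
      (coeffVec '' {g : MvPolynomial σ ℂ | wsComplexity g ≤ approxWsComplexity f}) :=
  Nat.sInf_mem (s := {r | coeffVec f ∈ zariskiClosure
      (coeffVec '' {g : MvPolynomial σ ℂ | wsComplexity g ≤ r})})
    ⟨wsComplexity f, subset_zariskiClosure _
      ⟨f, show wsComplexity f ≤ wsComplexity f from le_rfl, rfl⟩⟩

/-- Intro lemma for `\underline{L_ws}(f) ≤ r`. [cite: BurgisserEtAl2011, Def. 9.3.1] -/
theorem approxWsComplexity_le_of_mem {f : MvPolynomial σ ℂ} {r : ℕ}
    (h : coeffVec f ∈ zariskiClosure (coeffVec '' {g : MvPolynomial σ ℂ | wsComplexity g ≤ r})) :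
    approxWsComplexity f ≤ r := by
  unfold approxWsComplexity
  exact Nat.sInf_le h

/-- The sets `{g | L_ws(g) ≤ r}` have bounded supports (monomials of degree `≤ r + 1`).
[cite: BurgisserEtAl2011, §9.1 (VP_ws)] -/
theorem support_subset_degBox_of_wsComplexity_le [Fintype σ] [DecidableEq σ]
    {g : MvPolynomial σ ℂ} {r : ℕ}
    (hg : wsComplexity g ≤ r) :
    g.support ⊆ (Finset.range (r + 1 + 1)).biUnion
      (fun n => (Finset.univ : Finset σ).finsuppAntidiag n) :=
  support_subset_degBox_of_totalDegree_le
    ((totalDegree_le_wsComplexity_succ g).trans (Nat.succ_le_succ hg))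

/-- **`\underline{L_ws}` does not increase under input substitution** (variables ↦ variables or
constants): transport the closure along the linear map `aeval (inputVal φ)`
(`coeffVec_linearMap_mem_zariskiClosure`) and use `wsComplexity_aeval_inputVal_le` on the
approximants. [cite: BurgisserEtAl2011, §9.3 (closed under p-projections)] -/
theorem approxWsComplexity_aeval_inputVal_le [Fintype σ] [DecidableEq σ] (φ : σ → τ ⊕ ℂ)
    (f : MvPolynomial σ ℂ) :
    approxWsComplexity (aeval (ArithCircuit.inputVal φ) f) ≤ approxWsComplexity f := by
  have hf := coeffVec_mem_zariskiClosure_approxWsComplexity f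
  have h := coeffVec_linearMap_mem_zariskiClosure
    (aeval (ArithCircuit.inputVal φ) : MvPolynomial σ ℂ →ₐ[ℂ] MvPolynomial τ ℂ).toLinearMap
    (fun g hg => support_subset_degBox_of_wsComplexity_le hg) hf
  refine approxWsComplexity_le_of_mem (zariskiClosure_mono ?_ h)
  rintro _ ⟨_, ⟨g, hg, rfl⟩, rfl⟩
  exact ⟨aeval (ArithCircuit.inputVal φ) g, (wsComplexity_aeval_inputVal_le φ g).trans hg, rfl⟩

/-- **`\underline{L_ws}` does not increase under Valiant projections.**
[cite: BurgisserEtAl2011, §9.3 (closed under p-projections)] -/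
theorem IsProjection.approxWsComplexity_le [Fintype σ] [DecidableEq σ] {g : MvPolynomial τ ℂ}
    {f : MvPolynomial σ ℂ} (h : IsProjection g f) :
    approxWsComplexity g ≤ approxWsComplexity f := by
  obtain ⟨φ, rfl⟩ := h.exists_inputVal
  exact approxWsComplexity_aeval_inputVal_le φ f

/-- Renaming variables is a projection (Bürgisser 2000, Def. 2.6(1) / Rem. 2.2).
[cite: Burgisser2000, Def. 2.6(1)] -/
theorem isProjection_rename {k : Type*} [CommSemiring k] {σ' τ' : Type*} (e : σ' → τ')
    (f : MvPolynomial σ' k) : IsProjection (rename e f) f := by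
  refine ⟨fun i => X (e i), fun i => Or.inl ⟨e i, rfl⟩, ?_⟩
  have h : (rename e : MvPolynomial σ' k →ₐ[k] MvPolynomial τ' k) = aeval fun i => X (e i) := by
    ext i
    simp
  exact DFunLike.congr_fun h f

/-- `\underline{L_ws}` does not increase under renaming. [cite: BurgisserEtAl2011, §9.3 (closed under p-projections)] -/
theorem approxWsComplexity_rename_le [Fintype σ] [DecidableEq σ] (e : σ → τ)
    (f : MvPolynomial σ ℂ) :
    approxWsComplexity (rename e f) ≤ approxWsComplexity f :=
  (isProjection_rename e f).approxWsComplexity_le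

/-- `\underline{L_ws}` is invariant under renaming along a bijection of the variables.
[cite: BurgisserEtAl2011, §9.3 (closed under p-projections)] -/
theorem approxWsComplexity_rename_equiv [Fintype σ] [DecidableEq σ] [Fintype τ] [DecidableEq τ]
    (e : σ ≃ τ) (f : MvPolynomial σ ℂ) :
    approxWsComplexity (rename e f) = approxWsComplexity f := by
  refine le_antisymm (approxWsComplexity_rename_le e f) ?_
  have h := approxWsComplexity_rename_le e.symm (rename e f)
  rwa [rename_rename, e.symm_comp_self, rename_id] at h

/-- `L_ws` is invariant under renaming along a bijection of the variables.
[cite: BurgisserEtAl2011, §9.3 (closed under p-projections)] -/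
theorem wsComplexity_rename_equiv {k : Type*} [CommSemiring k] {σ' τ' : Type*} (e : σ' ≃ τ')
    (f : MvPolynomial σ' k) : wsComplexity (rename e f) = wsComplexity f := by
  refine le_antisymm (isProjection_rename e f).wsComplexity_le ?_
  have h := (isProjection_rename e.symm (rename e f)).wsComplexity_le
  rwa [rename_rename, e.symm_comp_self, rename_id] at h

/-- **BLMW 2011 §9.3: `\overline{VP_ws}` is closed under p-projections** ("both classes are
closed under p-projections", arXiv p. 21), for the tree's `IsVPwsBarFamily`: compose the p-bounded
size function with the p-bounded index map (`IsPBounded.comp_holds`) and use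
`IsProjection.approxWsComplexity_le` termwise. [cite: BurgisserEtAl2011, §9.3 (closed under p-projections)] -/
theorem IsVPwsBarFamily.of_isPProjection {σ' τ' : ℕ → Type*} [∀ n, Fintype (σ' n)]
    [∀ n, DecidableEq (σ' n)] [∀ n, Fintype (τ' n)] [∀ n, DecidableEq (τ' n)]
    {f : ∀ n, MvPolynomial (σ' n) ℂ} {g : ∀ n, MvPolynomial (τ' n) ℂ}
    (hg : IsVPwsBarFamily g) (h : IsPProjection f g) : IsVPwsBarFamily f := by
  obtain ⟨t, ht, hproj⟩ := h
  exact (IsPBounded.comp_holds hg ht).mono fun n => (hproj n).approxWsComplexity_le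

/-- `\overline{VP_ws}` membership is invariant under renaming each member along a bijection.
[cite: BurgisserEtAl2011, §9.3 (closed under p-projections)] -/
theorem isVPwsBarFamily_rename_equiv_iff {σ' τ' : ℕ → Type*} [∀ n, Fintype (σ' n)]
    [∀ n, DecidableEq (σ' n)] [∀ n, Fintype (τ' n)] [∀ n, DecidableEq (τ' n)]
    (e : ∀ n, σ' n ≃ τ' n) (f : ∀ n, MvPolynomial (σ' n) ℂ) :
    IsVPwsBarFamily (fun n => rename (e n) (f n)) ↔ IsVPwsBarFamily f := by
  unfold IsVPwsBarFamily
  simp only [approxWsComplexity_rename_equiv]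

end ApproxProjection

end Literature.Computability.AlgebraicComplexity
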